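import Summits.ValiantsHypothesis.ValiantsHypothesis.Theorems.BarrierLeverChowBenchmarkPairsBlockPeelCertKit
import Mathlib.LinearAlgebra.Matrix.Block

/-!
# Route BarrierLever — item 22038 `ChowBenchmarkPairs`, line `moore-peel`: the BLOCK PEEL — a DATA-FREE certificate kit:
# in-Lean LU decomposition modulo `p` on flat tables, with a KERNEL-CHECKED product test `L * U = A`

Helper file (`--supports stmt-ValiantsHypothesis-22038`; cell valiant-natproofs, rung V4, 𝒟-side benchmark of record,
line `moore_peel`, planner SUCCESSOR MANDATE M2 (HOME/STATUS.md l.1824: «rung 724 ONLY with a kernel-verified FAST checker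
(sparse LU / Bareiss …, ≤ 256 KB per file, ≤ 1 800 s)»); seat val-np-p4 gen 30).  Closes NO item; no certificate is checked
HERE (the per-block instance files do that, in the computational lane `Lean.ofReduceBool`, RULING R43 pattern).

THE PATTERN (why it is fast and what the kernel sees).  For a square matrix `A` over `ZMod p` of size `n`:
* `flatTable n A : Array ℕ` — the row-major table of `val`s (computed ONCE under evaluation; `flatTable_getD` is the kernel
  fact «the table is the matrix»);
* `luPacked a n p : Array ℕ` — an in-place Doolittle LU decomposition WITHOUT pivoting on the flat table (strict lower part =
  `L` with unit diagonal, upper part = `U`); this function is NOT verified and need not be: its output is only a CANDIDATE;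
* `luCheck a lu n p : Bool` — the checker: every diagonal entry of `U` is nonzero mod `p` and `(L * U)[i,j] ≡ A[i,j] (mod p)`
  for all `i, j`, the dot products computed by the structurally recursive accumulator `luDot` (masked to `k ≤ min i j`);
* KERNEL: `luDot_eq_sum`, `luMatL_mul_luMatU_eq` (`luCheck = true ⇒ L * U = A` as matrices over `ZMod p`),
  `det_luMatL` (`= 1`, lower unitriangular, `Matrix.det_of_lowerTriangular`), `det_luMatU_ne_zero` (`p` prime),
  **`det_ne_zero_of_luCheck`** and, for the block matrices of the peel,
  **`det_blockMatrix_X_ne_zero_of_luCheck`**: `luCheck (flatTable n (reindex e e (J^κ(i,t)(pt)))) lu n p = true ⇒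
  det J^κ(i,t)(Λ) ≠ 0` in `ℤ[Λ]` (through `det_blockMatrix_X_ne_zero_of_point` of `…BlockPeelCertKit`).
A certificate file then reads: `def a := flatTable n (reindex e e (blockMatrix κ i t pt))`, `def lu := luPacked a n p`,
`theorem chk : luCheck a lu n p = true := by native_decide` (the ONLY non-kernel step; no data at all), and the symbolic
determinant follows by `det_blockMatrix_X_ne_zero_of_luCheck`.  MEASURED (farm, val-np-p4 g30, `work/m2/FastProbe*.lean`):
random `365²` ≈ 20 s, `730²` ≈ 165 s wall — so the four 2-blocks of rung 724 (`727², 887², 1145², 1255²`) are within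
the `1 800 s` cap.

WHAT THIS IS NOT: nothing is certified in this file; node #1 `stub_segmentMeanValue` (∀ h) is untouched; nothing on crux
stmt-ValiantsHypothesis-14610 or on `VP` versus `VNP`.
-/

set_option linter.dupNamespace false

namespace Summit.ValiantsHypothesis.ValiantsHypothesis.Theorems.BarrierLever.MoorePeel

open Finset

/-! ## 1. Flat tables -/

/-- The flat row-major table (`n * i + j ↦ (A i j).val`) of a matrix over `ZMod p`. -/
def flatTable {p : ℕ} (n : ℕ) (A : Matrix (Fin n) (Fin n) (ZMod p)) : Array ℕ :=
  Array.ofFn fun idx : Fin (n * n) =>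
    (A ⟨idx.val / n, Nat.div_lt_of_lt_mul idx.2⟩
       ⟨idx.val % n, Nat.mod_lt _ (Nat.pos_of_ne_zero fun h => by have := idx.2; simp [h] at this)⟩).val

/-- KERNEL FACT: the table is the matrix. -/
theorem flatTable_getD {p : ℕ} (n : ℕ) (A : Matrix (Fin n) (Fin n) (ZMod p)) (i j : Fin n) :
    (flatTable n A).getD (n * i.val + j.val) 0 = (A i j).val := by
  have hn : 0 < n := Fin.pos i
  have hlt : n * i.val + j.val < n * n := by
    have := i.2; have := j.2; nlinarith
  rw [flatTable, Array.getD_eq_getD_getElem?, Array.getElem?_ofFn, dif_pos hlt, Option.getD_some]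
  have e1 : (n * i.val + j.val) / n = i.val := by
    rw [Nat.mul_add_div hn, Nat.div_eq_of_lt j.2, Nat.add_zero]
  have e2 : (n * i.val + j.val) % n = j.val := by
    rw [Nat.mul_add_mod, Nat.mod_eq_of_lt j.2]
  congr 2
  · exact Fin.ext e1
  · exact Fin.ext e2

/-! ## 2. The (unverified) LU routine and the (verified) checker -/

/-- `a ^ e mod p` by binary powering (64 rounds; exponents `< 2^64`). -/
def powModNat (a e p : ℕ) : ℕ := Id.run do
  let mut r := 1 % p
  let mut b := a % p
  let mut k := e
  for _ in [0:64] do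
    if k % 2 = 1 then r := (r * b) % p
    b := (b * b) % p
    k := k / 2
  return r

/-- **Candidate LU decomposition** (Doolittle, NO pivoting, in place, row-major flat table of size `n * n`): the strict
lower part of the result is `L` (unit diagonal implicit), the upper part including the diagonal is `U`.  Unverified —
if a zero pivot occurs the output is garbage and the checker fails. -/
def luPacked (a0 : Array ℕ) (n p : ℕ) : Array ℕ := Id.run do
  let mut a := a0
  for k in [0:n] do
    let inv := powModNat (a.getD (n * k + k) 0) (p - 2) p
    for i in [k+1:n] do
      let f := (a.getD (n * i + k) 0 * inv) % p
      a := a.set! (n * i + k) f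
      if f != 0 then
        let nf := p - f
        for j in [k+1:n] do
          a := a.set! (n * i + j) ((a.getD (n * i + j) 0 + nf * a.getD (n * k + j) 0) % p)
  return a

/-- `L[i,k]` read from the packed table: strict lower part, unit diagonal, zero above. -/
def luL (lu : Array ℕ) (n i k : ℕ) : ℕ := if k < i then lu.getD (n * i + k) 0 else if k = i then 1 else 0

/-- `U[k,j]` read from the packed table: upper part including the diagonal, zero below. -/
def luU (lu : Array ℕ) (n k j : ℕ) : ℕ := if k ≤ j then lu.getD (n * k + j) 0 else 0

/-- Accumulate `acc + Σ_{k < m} L[i,k] · U[k,j]` (structural recursion on `m`). -/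
def luDot (lu : Array ℕ) (n i j : ℕ) : ℕ → ℕ → ℕ
  | 0, acc => acc
  | m + 1, acc => luDot lu n i j m (acc + luL lu n i m * luU lu n m j)

/-- **The checker**: all diagonal entries of `U` nonzero mod `p`, and `(L * U)[i,j] ≡ A[i,j] (mod p)` for all `i, j < n`
(the dot product truncated at `k ≤ min i j`, beyond which the summands vanish). -/
def luCheck (a lu : Array ℕ) (n p : ℕ) : Bool :=
  (List.range n).all fun i =>
    (lu.getD (n * i + i) 0 % p != 0) &&
    (List.range n).all fun j => luDot lu n i j (min i j + 1) 0 % p == a.getD (n * i + j) 0 % p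

/-! ## 3. Kernel facts about the checker -/

/-- The accumulator computes the sum. -/
theorem luDot_eq_sum (lu : Array ℕ) (n i j : ℕ) (m acc : ℕ) :
    luDot lu n i j m acc = acc + ∑ k ∈ Finset.range m, luL lu n i k * luU lu n k j := by
  induction m generalizing acc with
  | zero => simp [luDot]
  | succ m ih => rw [luDot, ih, Finset.sum_range_succ]; ring

/-- Summands beyond `min i j` vanish. -/
theorem luL_mul_luU_eq_zero (lu : Array ℕ) (n i j k : ℕ) (hk : min i j < k) : luL lu n i k * luU lu n k j = 0 := by
  unfold luL luU
  rcases Nat.lt_or_ge i k with hik | hik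
  · rw [if_neg (Nat.lt_asymm hik), if_neg (Nat.ne_of_gt hik), zero_mul]
  · have hjk : j < k := by omega
    rw [if_neg (Nat.not_le.mpr hjk)]
    simp

/-- The full dot product equals the truncated one. -/
theorem sum_range_luL_mul_luU (lu : Array ℕ) (n i j : ℕ) (hi : i < n) :
    ∑ k ∈ Finset.range n, luL lu n i k * luU lu n k j =
      ∑ k ∈ Finset.range (min i j + 1), luL lu n i k * luU lu n k j := by
  symm
  refine Finset.sum_subset (fun k hk => ?_) (fun k _ hk => ?_)
  · rw [Finset.mem_range] at hk ⊢; omega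
  · rw [Finset.mem_range, not_lt] at hk
    exact luL_mul_luU_eq_zero lu n i j k (by omega)

section Matrices

variable (p : ℕ)

/-- `L` as a matrix over `ZMod p`. -/
def luMatL (lu : Array ℕ) (n : ℕ) : Matrix (Fin n) (Fin n) (ZMod p) := fun i k => (luL lu n i.val k.val : ZMod p)

/-- `U` as a matrix over `ZMod p`. -/
def luMatU (lu : Array ℕ) (n : ℕ) : Matrix (Fin n) (Fin n) (ZMod p) := fun k j => (luU lu n k.val j.val : ZMod p)

/-- The table `a` as a matrix over `ZMod p`. -/
def flatMat (a : Array ℕ) (n : ℕ) : Matrix (Fin n) (Fin n) (ZMod p) := fun i j => (a.getD (n * i.val + j.val) 0 : ZMod p)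

/-- **A passed check means `L * U = A`** over `ZMod p`. -/
theorem luMatL_mul_luMatU_eq (a lu : Array ℕ) (n : ℕ) (h : luCheck a lu n p = true) :
    luMatL p lu n * luMatU p lu n = flatMat p a n := by
  ext i j
  have hrow := List.all_eq_true.mp h i.val (List.mem_range.mpr i.2)
  rw [Bool.and_eq_true] at hrow
  have hij := List.all_eq_true.mp hrow.2 j.val (List.mem_range.mpr j.2)
  rw [beq_iff_eq, luDot_eq_sum, zero_add, ← sum_range_luL_mul_luU lu n i.val j.val i.2] at hij
  rw [Matrix.mul_apply, flatMat]
  simp only [luMatL, luMatU]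
  rw [← (ZMod.natCast_eq_natCast_iff' _ _ p).mpr hij, Nat.cast_sum]
  simp_rw [Nat.cast_mul]
  exact Fin.sum_univ_eq_sum_range (fun k => (luL lu n i.val k : ZMod p) * (luU lu n k j.val : ZMod p)) n

/-- `L` is lower unitriangular: `det L = 1`. -/
theorem det_luMatL (lu : Array ℕ) (n : ℕ) : (luMatL p lu n).det = 1 := by
  rw [Matrix.det_of_lowerTriangular (luMatL p lu n) (fun i j hij => by
    have hij' : i.val < j.val := hij
    simp only [luMatL, luL, if_neg (Nat.lt_asymm hij'), if_neg (Nat.ne_of_gt hij'), Nat.cast_zero])]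
  refine Finset.prod_eq_one fun i _ => ?_
  simp [luMatL, luL]

/-- `U` is upper triangular: `det U = ∏ U[k,k]`. -/
theorem det_luMatU (lu : Array ℕ) (n : ℕ) : (luMatU p lu n).det = ∏ k : Fin n, (lu.getD (n * k.val + k.val) 0 : ZMod p) := by
  rw [Matrix.det_of_upperTriangular (fun i j hij => by
    have hij' : j.val < i.val := hij
    simp only [luMatU, luU, if_neg (Nat.not_le.mpr hij'), Nat.cast_zero])]
  refine Finset.prod_congr rfl fun k _ => ?_
  simp [luMatU, luU]

/-- With `p` prime, a passed check makes `det U ≠ 0`. -/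
theorem det_luMatU_ne_zero [Fact p.Prime] (a lu : Array ℕ) (n : ℕ) (h : luCheck a lu n p = true) :
    (luMatU p lu n).det ≠ 0 := by
  rw [det_luMatU]
  refine Finset.prod_ne_zero_iff.mpr fun k _ hk => ?_
  have hrow := List.all_eq_true.mp h k.val (List.mem_range.mpr k.2)
  rw [Bool.and_eq_true] at hrow
  have hdiag := hrow.1
  rw [bne_iff_ne, ne_eq] at hdiag
  rw [ZMod.natCast_eq_zero_iff] at hk
  exact hdiag (Nat.mod_eq_zero_of_dvd hk)

/-- **A passed check certifies `det A ≠ 0`** (`p` prime). -/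
theorem det_flatMat_ne_zero_of_luCheck [Fact p.Prime] (a lu : Array ℕ) (n : ℕ) (h : luCheck a lu n p = true) :
    (flatMat p a n).det ≠ 0 := by
  rw [← luMatL_mul_luMatU_eq p a lu n h, Matrix.det_mul, det_luMatL, one_mul]
  exact det_luMatU_ne_zero p a lu n h

end Matrices

/-! ## 4. From a checked block table to the symbolic block determinant -/

/-- The flat table of `A` read back as a matrix IS `A`. -/
theorem flatMat_flatTable {p : ℕ} [NeZero p] (n : ℕ) (A : Matrix (Fin n) (Fin n) (ZMod p)) :
    flatMat p (flatTable n A) n = A := by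
  ext i j
  rw [flatMat, flatTable_getD, ZMod.natCast_zmod_val]

/-- **`det A ≠ 0` from the LU check of its flat table** (`p` prime). -/
theorem det_ne_zero_of_luCheck {p : ℕ} [Fact p.Prime] (n : ℕ) (A : Matrix (Fin n) (Fin n) (ZMod p)) (lu : Array ℕ)
    (h : luCheck (flatTable n A) lu n p = true) : A.det ≠ 0 := by
  have := det_flatMat_ne_zero_of_luCheck p (flatTable n A) lu n h
  rwa [flatMat_flatTable] at this

/-- **From a checked LU certificate of the tabulated block matrix to the symbolic block determinant**: for any weight
`κ`, block `(i, t)`, prime `p`, point `pt : Fin t → ZMod p`, window-order equivalence `e` and LU candidate `lu`,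
`luCheck (flatTable n (reindex e e (J^κ(i,t)(pt)))) lu n p = true ⇒ det J^κ(i,t)(Λ) ≠ 0` in `ℤ[Λ_0, …, Λ_{t-1}]`. -/
theorem det_blockMatrix_X_ne_zero_of_luCheck (κ : ℕ → ℕ) (i t n p : ℕ) [Fact p.Prime] (pt : Fin t → ZMod p)
    (e : BlockIdx i t ≃ Fin n) (lu : Array ℕ)
    (h : luCheck (flatTable n (Matrix.reindex e e (blockMatrix κ i t pt))) lu n p = true) :
    (blockMatrix κ i t (fun s : Fin t => (MvPolynomial.X s : MvPolynomial (Fin t) ℤ))).det ≠ 0 := by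
  refine det_blockMatrix_X_ne_zero_of_point κ i t pt ?_
  have := det_ne_zero_of_luCheck n _ lu h
  rwa [Matrix.det_reindex_self] at this

end Summit.ValiantsHypothesis.ValiantsHypothesis.Theorems.BarrierLever.MoorePeel
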